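import Summits.ResolutionOfSingularities.ResolutionOfSingularities.Theorems.FrobeniusClosingPatchingRelPerfectLetterTower
import Summits.ResolutionOfSingularities.ResolutionOfSingularities.Theorems.FrobeniusClosingPatchingRelPerfectCoreRungTowerCharts
import Summits.ResolutionOfSingularities.ResolutionOfSingularities.Theorems.FrobeniusClosingPatchingRelPerfectPointBlowupChartAssembly
import Summits.ResolutionOfSingularities.ResolutionOfSingularities.Theorems.FrobeniusClosingPatchingRelPerfectCoreRungSquarePlusLinearCharts
import HarnessLib

/-!
# Crux `PatchingRelPerfect` (stmt-ResolutionOfSingularities-16161), chain w52 — rung toolkit: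
# the TWO-LETTER tower with repeated factors (letters `{ℓ, 1}`)

[OURS · L1 W5.2 · rung tool] The side charts of the contact-migration member's companion
(PLAN-A2-certificate.md, addendum 3 (iii): on the charts `B₀, B₁, B₂` of `Bl_𝔪` the transform is
`uᴺ' · (h♯, 1)(h♯, u)³(h♯, u²)`) need the letter tower of `…LetterTower` WITHOUT the second letter
`o`: letters `L r ∈ {ℓ, 1}`, flag product `∏_{s<N} (c, L 0 ⋯ L s)` (repeated factors allowed).  PROVED:
`isRegular_of_isBlowup_letterTower_two` — every blowing up of `Spec R` along it is regular, for `R`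
a regular domain, `(c, ℓ)` quasi-regular with `R/(c, ℓ)` a regular domain and `ℓ ≠ 0` (nothing
else: no third letter, no pair hypothesis).  Same induction as the three-letter case (the `o`-branch
never fires).  Arbitrary regular domains; FORMAT evidence for the core stub only; nothing here is a
statement of the manuscript under review.

## References

* The Stacks Project, Tags 080A, 080B, 0804, 0BIQ. [StacksProject]
* Q. Liu, *Algebraic Geometry and Arithmetic Curves*, OUP 2002, Thm. 8.1.19 (a). [Liu2002]
* U. Görtz, T. Wedhorn, *Algebraic Geometry I*, 2nd ed. 2020, Prop. 13.91 (2), (13.19). [GortzWedhorn2020]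
-/

-- `Summit.<Summit>.<Sub>.Theorems` with `Sub = Summit` (single-conjunct summit, D-0017)
set_option linter.dupNamespace false

noncomputable section

open CategoryTheory CategoryTheory.Limits AlgebraicGeometry Literature.AlgebraicGeometry.Resolution
open IsLocalRing

namespace Summit.ResolutionOfSingularities.ResolutionOfSingularities.Theorems

namespace ConeRung

universe u

/-- **The two-letter tower with repeats is regular.**  `R` a regular domain, `(c, ℓ)` quasi-regular,
`R/(c, ℓ)` a regular domain, `ℓ ≠ 0`, `L : ℕ → R` with values in `{ℓ, 1}`: every blowing up of
`Spec R` along `∏_{s<N} (c, L 0 ⋯ L s)` is a regular scheme. [cite: StacksProject, Tag 080A]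
[cite: StacksProject, Tag 080B] [cite: Liu2002, Thm. 8.1.19 (a)] [cite: GortzWedhorn2020, Prop. 13.91 (2)] -/
theorem isRegular_of_isBlowup_letterTower_two (N : ℕ) :
    ∀ {R : Type u} [CommRing R] [IsRegularRing R] [IsDomain R] (c ℓ : R) (L : ℕ → R),
      (∀ r, L r = ℓ ∨ L r = 1) →
      IsQuasiRegular (Fin.cons c (fun _ : Fin 1 => ℓ) : Fin 2 → R) →
      IsDomain (R ⧸ Ideal.span {c, ℓ}) → IsRegularRing (R ⧸ Ideal.span {c, ℓ}) → ℓ ≠ 0 →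
      ∀ {Y : Scheme.{u}} {f : Y ⟶ Spec (.of R)},
        IsBlowup f (affineBlowup.idealSheaf (∏ s ∈ Finset.range N,
          Ideal.span {c, ∏ r ∈ Finset.range (s + 1), L r})) →
        Scheme.IsRegular Y := by
  induction N with
  | zero =>
    intro R _ _ _ c ℓ L _ _ _ _ _ Y f hf
    rw [Finset.prod_range_zero, Ideal.one_eq_top, affineBlowup.idealSheaf_top] at hf
    haveI : IsIso f := hf.isIso isEffectiveCartier_top
    haveI : IsRegularRing (CommRingCat.of R) := inferInstanceAs (IsRegularRing R)
    exact SectionAscent.TraceIdeal.isRegular_of_iso (asIso f) (Scheme.isRegular_Spec _)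
  | succ N ih =>
    intro R _ _ _ c ℓ L hL hcl hDl hRl hℓ0 Y f hf
    haveI := hDl; haveI := hRl
    rcases hL 0 with hL0 | hL0
    swap
    · -- a front letter `1`: the first factor is the unit ideal
      rw [letterTower_one c L hL0 N] at hf
      exact ih c ℓ (fun r => L (r + 1)) (fun r => hL (r + 1)) hcl hDl hRl hℓ0 hf
    -- a front letter `ℓ`: blow up `V(c, ℓ)`
    haveI : IsRegularRing (R ⧸ Ideal.span (Set.range (Fin.cons c (fun _ : Fin 1 => ℓ) :
        Fin 2 → R))) := IsRegularRing.of_ringEquiv (Ideal.quotEquivOfEq (step_span_pair_eq c ℓ))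
    rw [letterTower_succ c L N, hL0, step_span_pair_eq c ℓ] at hf
    -- the `c`-chart: the tail is the Cartier divisor `(c̄ᴺ)`
    have h0 : ∀ (Y' : Scheme.{u})
        (ρ : Y' ⟶ Spec (.of (chartRing (Fin.cons c (fun _ : Fin 1 => ℓ) : Fin 2 → R) 0))),
        IsBlowup ρ (affineBlowup.idealSheaf ((∏ s ∈ Finset.range N,
          Ideal.span {c, ∏ r ∈ Finset.range (s + 2), L r}).map
            (chartBase (Fin.cons c (fun _ : Fin 1 => ℓ) : Fin 2 → R) 0))) →
          Scheme.IsRegular Y' := by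
      intro Y' ρ hρ
      haveI : IsRegularRing (chartRing (Fin.cons c (fun _ : Fin 1 => ℓ) : Fin 2 → R) 0) :=
        isRegularRing_blowupChart _ 0 hcl
      have hc0 : chartBase (Fin.cons c (fun _ : Fin 1 => ℓ) : Fin 2 → R) 0 c ∈
          nonZeroDivisors _ :=
        reesChartBase_mem_nonZeroDivisors ((Fin.cons c (fun _ : Fin 1 => ℓ) : Fin 2 → R) 0)
          (Ideal.mem_span_range_self (f := (Fin.cons c (fun _ : Fin 1 => ℓ) : Fin 2 → R))
            (x := 0))
      have hl : chartBase (Fin.cons c (fun _ : Fin 1 => ℓ) : Fin 2 → R) 0 (L 0) =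
          chartBase (Fin.cons c (fun _ : Fin 1 => ℓ) : Fin 2 → R) 0 c *
            chartGen (Fin.cons c (fun _ : Fin 1 => ℓ) : Fin 2 → R) 0 (Fin.succ 0) := by
        rw [hL0]
        exact reesChartBase_apply_eq_mul_chartGen (Fin.cons c (fun _ : Fin 1 => ℓ) : Fin 2 → R)
          0 (Fin.succ 0)
      rw [map_letterTail_eq_span_pow (chartBase (Fin.cons c (fun _ : Fin 1 => ℓ) :
          Fin 2 → R) 0) c L _ _ rfl hl N] at hρ
      exact isRegular_of_isBlowup_idealSheaf_span_singleton_of_isRegularRing (pow_mem hc0 N) hρ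
    -- the `ℓ`-chart: `(ℓ'ᴺ) ·` the tower of `(c', ℓ')` with letters `ψ ∘ L ∘ succ`
    have h1 : ∀ (Y' : Scheme.{u})
        (ρ : Y' ⟶ Spec (.of (chartRing (Fin.cons c (fun _ : Fin 1 => ℓ) : Fin 2 → R)
          (Fin.succ 0)))),
        IsBlowup ρ (affineBlowup.idealSheaf ((∏ s ∈ Finset.range N,
          Ideal.span {c, ∏ r ∈ Finset.range (s + 2), L r}).map
            (chartBase (Fin.cons c (fun _ : Fin 1 => ℓ) : Fin 2 → R) (Fin.succ 0)))) →
          Scheme.IsRegular Y' := by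
      intro Y' ρ hρ
      haveI : IsRegularRing (chartRing (Fin.cons c (fun _ : Fin 1 => ℓ) : Fin 2 → R)
        (Fin.succ 0)) := step_isRegularRing c ℓ hcl
      haveI : IsDomain (chartRing (Fin.cons c (fun _ : Fin 1 => ℓ) : Fin 2 → R)
        (Fin.succ 0)) := step_isDomain c ℓ hℓ0
      have hlz : chartBase (Fin.cons c (fun _ : Fin 1 => ℓ) : Fin 2 → R) (Fin.succ 0) ℓ ∈
          nonZeroDivisors _ :=
        reesChartBase_mem_nonZeroDivisors
          ((Fin.cons c (fun _ : Fin 1 => ℓ) : Fin 2 → R) (Fin.succ 0))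
          (Ideal.mem_span_range_self (f := (Fin.cons c (fun _ : Fin 1 => ℓ) : Fin 2 → R))
            (x := Fin.succ 0))
      have hl : chartBase (Fin.cons c (fun _ : Fin 1 => ℓ) : Fin 2 → R) (Fin.succ 0) (L 0) =
          chartBase (Fin.cons c (fun _ : Fin 1 => ℓ) : Fin 2 → R) (Fin.succ 0) ℓ := by
        rw [hL0]
      rw [map_letterTail (chartBase (Fin.cons c (fun _ : Fin 1 => ℓ) : Fin 2 → R)
          (Fin.succ 0)) c L _ _
        (reesChartBase_apply_eq_mul_chartGen (Fin.cons c (fun _ : Fin 1 => ℓ) : Fin 2 → R)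
          (Fin.succ 0) 0) hl N] at hρ
      have hL' : ∀ r, chartBase (Fin.cons c (fun _ : Fin 1 => ℓ) : Fin 2 → R) (Fin.succ 0)
          (L (r + 1)) = chartBase (Fin.cons c (fun _ : Fin 1 => ℓ) : Fin 2 → R) (Fin.succ 0) ℓ ∨
          chartBase (Fin.cons c (fun _ : Fin 1 => ℓ) : Fin 2 → R) (Fin.succ 0)
            (L (r + 1)) = 1 := fun r => by
        rcases hL (r + 1) with h | h
        · exact Or.inl (by rw [h])
        · exact Or.inr (by rw [h, map_one])
      exact CoreRungTower.isRegular_of_isBlowup_span_singleton_mul (pow_mem hlz N) _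
        (fun Y'' ρ' hρ' => ih _ _ (fun r => chartBase (Fin.cons c (fun _ : Fin 1 => ℓ) :
            Fin 2 → R) (Fin.succ 0) (L (r + 1))) hL'
          (stepP_isQuasiRegular_c'ℓ' c ℓ hcl hℓ0)
          (step_isDomain_quot_c'ℓ' c ℓ hcl) (step_isRegularRing_quot_c'ℓ' c ℓ hcl)
          (nonZeroDivisors.ne_zero hlz) hρ') hρ
    exact isRegular_of_isBlowup_mul_of_charts (Fin.cons c (fun _ : Fin 1 => ℓ) : Fin 2 → R) _
      (fun i => Fin.cases (motive := fun i => ∀ (Y' : Scheme.{u})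
        (ρ : Y' ⟶ Spec (.of (chartRing (Fin.cons c (fun _ : Fin 1 => ℓ) : Fin 2 → R) i))),
        IsBlowup ρ (affineBlowup.idealSheaf ((∏ s ∈ Finset.range N,
          Ideal.span {c, ∏ r ∈ Finset.range (s + 2), L r}).map
            (chartBase (Fin.cons c (fun _ : Fin 1 => ℓ) : Fin 2 → R) i))) →
          Scheme.IsRegular Y') h0 (fun k => by
            obtain rfl : k = 0 := Subsingleton.elim _ _
            exact h1) i) hf

end ConeRung

end Summit.ResolutionOfSingularities.ResolutionOfSingularities.Theorems

end
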